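import Summits.BirchSwinnertonDyer.BirchSwinnertonDyer.Theses.UniversalToricDescent
import Literature.NumberTheory.EllipticCurves.HeegnerModuleIndex
import Literature.NumberTheory.EllipticCurves.GreenbergSelmer
import Literature.NumberTheory.EllipticCurves.IwasawaSelmer

/-!
# Sketch — crux ideas on `UniversalToricDescent.TwinAlgMuZeroAtThree` (stmt-BirchSwinnertonDyer-24254)
planner bsd-wall-utd-idea g51. First lemmas of the idea `local-indivisibility-road` (card
`idea-local-indivisibility-road.md`): statements only (`def … : Prop`), typed over tree declarations.
Nothing here is proved or asserted; BSD is not advanced by this file.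
-/

set_option autoImplicit false
set_option linter.dupNamespace false

noncomputable section

open scoped Classical

namespace Summit.BirchSwinnertonDyer.BirchSwinnertonDyer.Cruxes.TwinAlgMuZeroAtThree.LocalIndivisibilityRoad

open NumberField IsDedekindDomain Field WeierstrassCurve
open Literature.NumberTheory.EllipticCurves Literature.NumberTheory.EllipticCurves.GreenbergSelmer
open Summit.BirchSwinnertonDyer.Rank1Residual.X11b Summit.BirchSwinnertonDyer.Rank1Residual.X11b.AcSelmer

/-- **L1 (first checkable lemma; pure `Λ`-algebra).** `Λ = ℤ₃⟦T⟧`; `U` a free `Λ`-module of rank one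
(the local universal-norm module `H¹_Iw(K_{∞,𝔭}, T₃E′)` at the RELAXED prime `𝔭`), `u ∈ U` (the
localisation of the `Λ`-adic Heegner class), `π : U → V` a `Λ`-linear map (localisation to ONE layer
`K_k`). If `π u ∉ 3V` then `U/Λu` is `Λ`-torsion with `μ = 0`, in the route's currency
(`Ch·R₀⟦T⟧ = (g)`, `g` with a norm-one coefficient). -/
def FreeRankOneIndivisible : Prop :=
  ∀ (U : Type) [AddCommGroup U] [Module (IwasawaAlgebra 3) U] [Module.Free (IwasawaAlgebra 3) U]
    (V : Type) [AddCommGroup V] [Module (IwasawaAlgebra 3) V]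
    (π : U →ₗ[IwasawaAlgebra 3] V) (u : U),
    Module.finrank (IwasawaAlgebra 3) U = 1 →
    (¬ ∃ v : V, π u = (3 : IwasawaAlgebra 3) • v) →
    Module.IsTorsion (IwasawaAlgebra 3) (U ⧸ Submodule.span (IwasawaAlgebra 3) {u}) ∧
      ∃ g : UnrSeries 3,
        (Module.charIdeal (IwasawaAlgebra 3) (U ⧸ Submodule.span (IwasawaAlgebra 3) {u})).map
            (PowerSeries.map (Halves.toUnr 3)) = Ideal.span {g} ∧
          ∃ i : ℕ, ‖((PowerSeries.coeff i g : unrIntegers 3) : ℂ_[3])‖ = 1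

/-- **K1 `(β_k)` — local 3-indivisibility of ONE Heegner layer at the relaxed prime `𝔭`.** For a
Heegner family `F` of the twin `E′ = W′` over the anticyclotomic `ℤ₃`-tower (`F.z k =
Norm_{K[3^{k+1}]/K_k} P[3^{k+1}] ∈ E′(K_k)`), SOME layer point `z_k` has NON-ZERO mod-3 Kummer class
restricted to the decomposition group at `𝔭` inside `Gal(K̄/K_k)`, i.e. `z_k ∉ 3·E′(K_{k,w})` for the
place `w ∣ 𝔭` of `K_k` fixed by the tree's `decomp 𝔭`. (Decidable per `(E′, K, k)`.) -/
def LocalIndivisibleLayer {N' : ℕ} [NeZero N'] (W' : WeierstrassCurve ℚ) (K : Type) [Field K]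
    [NumberField K] (κ : ZpExtension K 3) (jbar : AlgebraicClosure K →+* ℂ)
    (F : HeegnerFamily N' W' K κ jbar) (𝔭 : HeightOneSpectrum (𝓞 K)) : Prop :=
  ∃ k : ℕ, ∀ (Q : geomPoints (W'.baseChange K))
    (hQ : ∀ σ ∈ κ.layerSubgroup k ⊓ decomp 𝔭, σ • ((3 : ℤ) • Q) = (3 : ℤ) • Q),
    (3 : ℤ) • Q = F.z k →
      (W'.baseChange K).kummerClassOver (κ.layerSubgroup k ⊓ decomp 𝔭) 3 Q hQ ≠ 0

/-- **K2 — Howard's Theorem B for the twin at MULTIPLICATIVE `p = 3` (beyond print: Howard 2004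
assumes `p ∤ N`, good ordinary, `3`-adic surjectivity).** Conclusion shape = the tree's
`Howard2004_thmB` verbatim, binders = bucket B of the twin (`Mult W′ 3`, `3 ∤ v₃(Δ′)`, `ρ̄` onto,
classical Heegner `K`, odd `d_K`). -/
def HowardDivisibilityMultThree : Prop :=
  ∀ (N' : ℕ) [NeZero N'] (W' : WeierstrassCurve ℚ) [W'.IsElliptic] [W'.IsGloballyMinimal]
    (K : Type) [Field K] [NumberField K] (κ : ZpExtension K 3) (γ : absoluteGaloisGroup K)
    (jbar : AlgebraicClosure K →+* ℂ),
    Rank1Residual.Mult W' 3 → ¬ 3 ∣ padicValInt 3 W'.minimalDiscriminantInt →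
    W'.HasSurjectiveModNGaloisRep 3 → W'.conductorNorm ℤ = N' → IsImaginaryQuadratic K →
    SatisfiesHeegnerHypothesis N' K → Odd (NumberField.discr K) → κ.IsAnticyclotomic →
    κ.IsTopGenerator γ →
    ∀ (D : (W'.baseChange K).LambdaAdicSelmerData κ γ) (F : HeegnerFamily N' W' K κ jbar)
      (X : (W'.baseChange K).SelmerDualData κ γ),
      (Module.Finite (IwasawaAlgebra 3) D.S ∧ NoZeroSMulDivisors (IwasawaAlgebra 3) D.S ∧
          Module.finrank (IwasawaAlgebra 3) D.S = 1) ∧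
        (Module.Finite (IwasawaAlgebra 3) X.X ∧ Module.finrank (IwasawaAlgebra 3) X.X = 1 ∧
          Module.charIdeal (IwasawaAlgebra 3) (Submodule.torsion (IwasawaAlgebra 3) X.X) ∣
            heegnerCharIdeal D F ^ 2)

/-- **The thesis of the card on bucket B (`(β)`-road): K2 ∧ K1 ⟹ the conclusion of
`TwinAlgMuZeroAtThree` for a très-ramifié multiplicative twin**, in the route's exact currency
(`XAc (W′_K) 3 κ 𝔭′ ∅ γ`: strict at `𝔭′`, relaxed at `𝔭`). The implication itself is the support
item P1 (Poitou–Tate bookkeeping `char X_{∅,0} ∣ char(U_𝔭/Λ·loc_𝔭 κ_∞)²` under K2, then L1). -/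
def BetaRoadMultThree : Prop :=
  HowardDivisibilityMultThree →
  ∀ (W' : WeierstrassCurve ℚ) [W'.IsElliptic] [W'.IsGloballyMinimal] (N' : ℕ) [NeZero N']
    (K : Type) [Field K] [NumberField K]
    (Dt' : Literature.NumberTheory.EllipticCurves.ModularForms.ModularParametrizationData W' N'),
    Rank1Residual.Mult W' 3 → ¬ 3 ∣ padicValInt 3 W'.minimalDiscriminantInt →
    W'.HasSurjectiveModNGaloisRep 3 → W'.conductorNorm ℤ = N' → IsImaginaryQuadratic K →
    SatisfiesHeegnerHypothesis N' K → Odd (NumberField.discr K) →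
    ∀ (κ : ZpExtension K 3), κ.IsAnticyclotomic →
    ∀ (γ : absoluteGaloisGroup K) [Fact (κ.IsTopGenerator γ)]
      (𝔭 : HeightOneSpectrum (𝓞 K)), ((3 : ℕ) : 𝓞 K) ∈ 𝔭.asIdeal →
      𝔭.asIdeal.ramificationIdx (𝓞 ℚ) = 1 → 𝔭.asIdeal.inertiaDeg (𝓞 ℚ) = 1 →
    ∀ (𝔭' : HeightOneSpectrum (𝓞 K)), ((3 : ℕ) : 𝓞 K) ∈ 𝔭'.asIdeal → 𝔭' ≠ 𝔭 →
    ∀ (jbar : AlgebraicClosure K →+* ℂ) (F : HeegnerFamily N' W' K κ jbar),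
      LocalIndivisibleLayer W' K κ jbar F 𝔭 →
      Module.IsTorsion (IwasawaAlgebra 3) (XAc (W'.baseChange K) 3 κ 𝔭' ∅ γ) ∧
        ∃ g' : UnrSeries 3,
          (XAc.charIdeal (W'.baseChange K) 3 κ 𝔭' ∅ γ).map (PowerSeries.map (Halves.toUnr 3)) =
              Ideal.span {g'} ∧
            ∃ i : ℕ, ‖((PowerSeries.coeff i g' : unrIntegers 3) : ℂ_[3])‖ = 1

end Summit.BirchSwinnertonDyer.BirchSwinnertonDyer.Cruxes.TwinAlgMuZeroAtThree.LocalIndivisibilityRoad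

end
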